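import Mathlib

/-!
# Monotone Schur step: a certified LOWER BOUND on a pivot propagates through block elimination
(cap g3, cell `ns-blowup`, 2026-08-26)

HONEST FRAMING (human ruling D-0035): nothing here is a claim about Navier–Stokes blow-up.
WHAT THIS IS NOT: not NS evidence. Kernel form of the linear-algebra step behind the cap seat's
«monotone a-posteriori skew-cut recursion» (driver `HOME/cap/d2/d2_cert.py`, PREREG «D2-3L-X0»,
`STATUS.md` l.1438; INSTAB-BRIDGE §12 (L4′)): to certify that a Hermitian block-tridiagonal matrix
`N` is positive definite one eliminates shell by shell, `P₀ = N₀₀`, `P_u = N_uu − Cᴴ P_{u−1}⁻¹ C`;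
in ball arithmetic one never holds `P_{u−1}` exactly but only an EXACT Hermitian lower bound
`L ≼ P_{u−1}` with `L ≻ 0` certified. The step is sound because the Schur complement is MONOTONE in
the pivot: `L ≼ P`, `L ≻ 0` imply `Cᴴ P⁻¹ C ≼ Cᴴ L⁻¹ C`, i.e. `D − Cᴴ L⁻¹ C ≼ D − Cᴴ P⁻¹ C`, so a
certified `D − Cᴴ L⁻¹ C ≻ 0` gives `[[P, C], [Cᴴ, D]] ≻ 0` and a valid lower bound for the next
level. The proof is inverse-free completing of squares (no spectral theorem):
`cᴴL⁻¹c − cᴴP⁻¹c = (y − z)ᴴ L (y − z) + yᴴ (P − L) y ≥ 0` with `y = P⁻¹c`, `z = L⁻¹c`.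

* `dotProduct_inv_mulVec_le` — `cᴴ P⁻¹ c ≤ cᴴ L⁻¹ c` for `0 ≺ L ≼ P`.
* `posSemidef_conjTranspose_inv_sub` — `Cᴴ L⁻¹ C − Cᴴ P⁻¹ C ≽ 0`.
* `schurComplement_mono` — `(D − Cᴴ P⁻¹ C) − (D − Cᴴ L⁻¹ C) ≽ 0`.
* `posDef_fromBlocks_of_pivot_lowerBound` — `0 ≺ L ≼ P` and `D − Cᴴ L⁻¹ C ≻ 0` imply
  `fromBlocks P C Cᴴ D ≻ 0` (the recursion step; iterate it along the shells).
* `cross_term_absorb` — the scalar completed square that absorbs the head–tail cross term of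
  THEOREM 3-L into the last diagonal block: `n − b s t + τ η t² ≥ n − (b²/(4τη)) s²`.

Mathlib only (`Matrix.PosDef`, `Matrix.schur_complement_eq₁₁`); no new definitions.
-/

namespace Summit.NavierStokesRegularity.FluidComputer.MonotoneSchurStep

open Matrix

variable {K : Type*} [Field K] [PartialOrder K] [StarRing K] [StarOrderedRing K]
variable {m n : Type*} [Fintype m] [Fintype n] [DecidableEq m]

/-- **Quadratic forms of inverses are antitone in the matrix.** If `L` is positive definite and
`P − L` is positive semidefinite then `cᴴ P⁻¹ c ≤ cᴴ L⁻¹ c` for every vector `c`. Inverse-free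
proof: with `y = P⁻¹c`, `z = L⁻¹c`,
`cᴴL⁻¹c − cᴴP⁻¹c = (y − z)ᴴ L (y − z) + yᴴ(P − L)y`. -/
theorem dotProduct_inv_mulVec_le {L P : Matrix m m K} (hL : L.PosDef) (hPL : (P - L).PosSemidef)
    (c : m → K) : star c ⬝ᵥ (P⁻¹ *ᵥ c) ≤ star c ⬝ᵥ (L⁻¹ *ᵥ c) := by
  have hP : P.PosDef := by simpa using hL.add_posSemidef hPL
  have hLu : IsUnit L.det := (Matrix.isUnit_iff_isUnit_det _).mp hL.isUnit
  have hPu : IsUnit P.det := (Matrix.isUnit_iff_isUnit_det _).mp hP.isUnit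
  obtain ⟨y, hy⟩ : ∃ y : m → K, y = P⁻¹ *ᵥ c := ⟨_, rfl⟩
  obtain ⟨z, hz⟩ : ∃ z : m → K, z = L⁻¹ *ᵥ c := ⟨_, rfl⟩
  have hPy : P *ᵥ y = c := by
    rw [hy, mulVec_mulVec, Matrix.mul_nonsing_inv _ hPu, one_mulVec]
  have hLz : L *ᵥ z = c := by
    rw [hz, mulVec_mulVec, Matrix.mul_nonsing_inv _ hLu, one_mulVec]
  -- scalar identities
  have h1 : star c ⬝ᵥ y = star y ⬝ᵥ (P *ᵥ y) := by
    conv_lhs => rw [← hPy]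
    rw [star_mulVec, ← dotProduct_mulVec, hP.isHermitian.eq]
  have h2 : star y ⬝ᵥ c = star y ⬝ᵥ (P *ᵥ y) := by rw [hPy]
  have h3 : star c ⬝ᵥ z = star z ⬝ᵥ (L *ᵥ z) := by
    conv_lhs => rw [← hLz]
    rw [star_mulVec, ← dotProduct_mulVec, hL.isHermitian.eq]
  have h4 : star z ⬝ᵥ c = star z ⬝ᵥ (L *ᵥ z) := by rw [hLz]
  have h5 : star z ⬝ᵥ (L *ᵥ y) = star c ⬝ᵥ y := by
    calc star z ⬝ᵥ (L *ᵥ y) = (star z ᵥ* L) ⬝ᵥ y := dotProduct_mulVec _ _ _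
      _ = star (L *ᵥ z) ⬝ᵥ y := by rw [star_mulVec, hL.isHermitian.eq]
      _ = star c ⬝ᵥ y := by rw [hLz]
  have h6 : star y ⬝ᵥ (L *ᵥ z) = star y ⬝ᵥ c := by rw [hLz]
  -- the two nonnegative pieces
  have T1 : 0 ≤ star (y - z) ⬝ᵥ (L *ᵥ (y - z)) := hL.posSemidef.dotProduct_mulVec_nonneg _
  have T2 : 0 ≤ star y ⬝ᵥ ((P - L) *ᵥ y) := hPL.dotProduct_mulVec_nonneg _
  have e1 : star (y - z) ⬝ᵥ (L *ᵥ (y - z)) =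
      star y ⬝ᵥ (L *ᵥ y) - star y ⬝ᵥ (L *ᵥ z) - star z ⬝ᵥ (L *ᵥ y) + star z ⬝ᵥ (L *ᵥ z) := by
    rw [star_sub, mulVec_sub, sub_dotProduct, dotProduct_sub, dotProduct_sub]; abel
  have e2 : star y ⬝ᵥ ((P - L) *ᵥ y) = star y ⬝ᵥ (P *ᵥ y) - star y ⬝ᵥ (L *ᵥ y) := by
    rw [sub_mulVec, dotProduct_sub]
  have key : star c ⬝ᵥ (L⁻¹ *ᵥ c) - star c ⬝ᵥ (P⁻¹ *ᵥ c) =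
      star (y - z) ⬝ᵥ (L *ᵥ (y - z)) + star y ⬝ᵥ ((P - L) *ᵥ y) := by
    rw [e1, e2, ← hz, ← hy]
    linear_combination (h6.trans h2) + h5 + h3
  rw [← sub_nonneg, key]
  exact add_nonneg T1 T2

/-- **Monotone Schur complement (matrix form).** For `0 ≺ L ≼ P` and any `C`,
`Cᴴ L⁻¹ C − Cᴴ P⁻¹ C` is positive semidefinite. -/
theorem posSemidef_conjTranspose_inv_sub {L P : Matrix m m K} (hL : L.PosDef)
    (hPL : (P - L).PosSemidef) (C : Matrix m n K) :
    (Cᴴ * L⁻¹ * C - Cᴴ * P⁻¹ * C).PosSemidef := by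
  have hP : P.PosDef := by simpa using hL.add_posSemidef hPL
  refine PosSemidef.of_dotProduct_mulVec_nonneg ?_ fun x => ?_
  · exact (isHermitian_conjTranspose_mul_mul C hL.isHermitian.inv).sub
      (isHermitian_conjTranspose_mul_mul C hP.isHermitian.inv)
  · have hq : ∀ M : Matrix m m K, star x ⬝ᵥ ((Cᴴ * M * C) *ᵥ x) =
        star (C *ᵥ x) ⬝ᵥ (M *ᵥ (C *ᵥ x)) := by
      intro M
      rw [← mulVec_mulVec, ← mulVec_mulVec, dotProduct_mulVec, star_mulVec]
    rw [sub_mulVec, dotProduct_sub, hq, hq, sub_nonneg]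
    exact dotProduct_inv_mulVec_le hL hPL (C *ᵥ x)

/-- **The Schur complement is monotone in the pivot.** For `0 ≺ L ≼ P`,
`D − Cᴴ L⁻¹ C ≼ D − Cᴴ P⁻¹ C`. This is what lets the interval recursion replace the true pivot
by any certified exact lower bound. -/
theorem schurComplement_mono {L P : Matrix m m K} (hL : L.PosDef) (hPL : (P - L).PosSemidef)
    (C : Matrix m n K) (D : Matrix n n K) :
    ((D - Cᴴ * P⁻¹ * C) - (D - Cᴴ * L⁻¹ * C)).PosSemidef := by
  have h := posSemidef_conjTranspose_inv_sub hL hPL C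
  convert h using 1
  abel

/-- **The recursion step.** If `0 ≺ L ≼ P` (an exact certified lower bound of the current pivot)
and the NEXT pivot computed with `L` in place of `P` is positive definite, `D − Cᴴ L⁻¹ C ≻ 0`,
then the two-level block matrix `[[P, C], [Cᴴ, D]]` is positive definite. Iterating over the
shells (each Schur complement is again bounded below, by `schurComplement_mono`) gives
positive definiteness of the whole block-tridiagonal matrix from the per-level certificates. -/
theorem posDef_fromBlocks_of_pivot_lowerBound {L P : Matrix m m K} (hL : L.PosDef)
    (hPL : (P - L).PosSemidef) (C : Matrix m n K) {D : Matrix n n K}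
    (hS : (D - Cᴴ * L⁻¹ * C).PosDef) : (Matrix.fromBlocks P C Cᴴ D).PosDef := by
  have hP : P.PosDef := by simpa using hL.add_posSemidef hPL
  letI : Invertible P := hP.isUnit.invertible
  have hSP : (D - Cᴴ * P⁻¹ * C).PosDef := by
    simpa using hS.add_posSemidef (schurComplement_mono hL hPL C D)
  refine PosDef.of_dotProduct_mulVec_pos ?_ fun v hv => ?_
  · exact (IsHermitian.fromBlocks₁₁ C D hP.isHermitian).mpr hSP.isHermitian
  · rw [dotProduct_mulVec, ← Sum.elim_comp_inl_inr v,
      schur_complement_eq₁₁ C D _ _ hP.isHermitian]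
    set u := v ∘ Sum.inl with hu
    set x := v ∘ Sum.inr with hx
    have hA : 0 ≤ star (u + (P⁻¹ * C) *ᵥ x) ᵥ* P ⬝ᵥ (u + (P⁻¹ * C) *ᵥ x) := by
      rw [← dotProduct_mulVec]; exact hP.posSemidef.dotProduct_mulVec_nonneg _
    by_cases hx0 : x = 0
    · have hu0 : u ≠ 0 := by
        intro h0; apply hv
        rw [← Sum.elim_comp_inl_inr v]
        ext i; rcases i with i | i
        · simpa [hu] using congrFun h0 i
        · simpa [hx] using congrFun hx0 i
      have hpos : 0 < star (u + (P⁻¹ * C) *ᵥ x) ᵥ* P ⬝ᵥ (u + (P⁻¹ * C) *ᵥ x) := by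
        rw [← dotProduct_mulVec, hx0, mulVec_zero, add_zero]
        exact hP.dotProduct_mulVec_pos hu0
      have hB : 0 ≤ star x ᵥ* (D - Cᴴ * P⁻¹ * C) ⬝ᵥ x := by
        rw [← dotProduct_mulVec]; exact hSP.posSemidef.dotProduct_mulVec_nonneg _
      exact add_pos_of_pos_of_nonneg hpos hB
    · have hB : 0 < star x ᵥ* (D - Cᴴ * P⁻¹ * C) ⬝ᵥ x := by
        rw [← dotProduct_mulVec]; exact hSP.dotProduct_mulVec_pos hx0
      exact add_pos_of_nonneg_of_pos hA hB

/-- **Cross-term absorption (the completed square of THEOREM 3-L's head–tail coupling).** For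
reals with `τ > 0`, `η > 0`: `n − b·s·t + τη·t² ≥ n − (b²/(4τη))·s²` — so subtracting
`b²/(4τη)` from the last diagonal block of the head form absorbs a cross term of size `b·s·t`
against a tail dissipation `τη·t²`, uniformly in the tail amplitude `t`. -/
theorem cross_term_absorb (n b s t τ η : ℝ) (hτ : 0 < τ) (hη : 0 < η) :
    n - b ^ 2 / (4 * τ * η) * s ^ 2 ≤ n - b * s * t + τ * η * t ^ 2 := by
  have h4 : 0 < 4 * τ * η := by positivity
  have key : 0 ≤ τ * η * (t - b * s / (2 * τ * η)) ^ 2 := by positivity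
  have expand : τ * η * (t - b * s / (2 * τ * η)) ^ 2
      = τ * η * t ^ 2 - b * s * t + b ^ 2 / (4 * τ * η) * s ^ 2 := by
    field_simp
    ring
  linarith [key, expand]

end Summit.NavierStokesRegularity.FluidComputer.MonotoneSchurStep
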